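import Summits.Ventures.HodgeRepro2.T5SU11JacobiPhaseTailGroup
import Summits.Ventures.HodgeRepro2.T5SU11OrbitRadiusLaw

/-!
# The rescaled orbit radius converges in law to the standard exponential law, for every `λ`

`T5SU11JacobiPhaseLawAsymptotic` / `T5SU11JacobiPhaseTailGroup` give `P_{k,λ}(k · log|a| > x) → e^{−x}`.
This file first generalises the moving-domain dominated convergence to ANY sequence of thresholds
`a_k → x` (`tendsto_tail_integral_of_tendsto`), and the tail substitution to any threshold
(`tail_phase_eq'`), so that

  **`P_{k,λ}(log|a| > t_k) → e^{−x}` whenever `(k − 2) t_k → x`**   (`tendsto_phase_tail_prob_of_tendsto`).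

Applied to the squared orbit radius `|g·0|² = 1 − |a|^{−2}`, i.e. `{|g·0|² > y} = {log|a| > −½ log(1 − y)}`
(`T5SU11OrbitRadiusLaw.setOf_norm_orbit_sq_gt_eq`), with `y = 2x/k` and
`−½ (k − 2) log(1 − 2x/k) → x` (`tendsto_scaled_log_threshold`, the derivative of `log` at `1`):

  **`P_{k,λ}(k |g·0|²/2 > x) → e^{−x}`**   (`tendsto_orbit_sq_tail_prob_atTop`)

for every real `λ` and every `x > 0` — the rescaled orbit radius converges in distribution to `Exp(1)`;
at `λ = 0` the law is exactly `Beta(1, (k−2)/2)` (`T5SU11OrbitRadiusLaw`), whose tail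
`(1 − 2x/k)^{(k−2)/2} → e^{−x}` is the classical Beta-to-exponential limit. Nothing is claimed about (N).

Blind lane: Mathlib + the HodgeRepro2 prefix only; no sorry; axioms ⊆ {propext, Classical.choice,
Quot.sound}.
-/

namespace Summit.Ventures.HodgeRepro2.T5SU11JacobiOrbitLawAsymptotic

open MeasureTheory MeasureTheory.Measure Metric Set Filter Topology
open T5SU11Unimodular T5SU11Fibration T5SU11Cartan T5SU11OneParameter T5SU11CartanProjection T5HaarCircle
  T5BergmanCoefficient T5SU11FibrationHaar T5SU11SphericalFunction T5SU11SphericalSymmetry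
  T5SU11SphericalBounds T5SU11SphericalContinuous T5SU11JacobiIwasawa T5SU11JacobiTransform
  T5SU11JacobiWeight T5SU11KFiniteMajorantPow T5SU11JacobiWeightDeriv T5SU11PhaseLaw
  T5SU11PhaseLawLintegral T5SU11JacobiLaplacePhase T5SU11PhaseTail T5SU11OrbitRadiusLaw
  T5SU11JacobiPhaseMomentsAsymptotic T5SU11JacobiPhaseLawAsymptotic T5SU11JacobiPhaseTailGroup
open scoped Real

/-! ### The threshold `−½ (k − 2) log(1 − 2x/k) → x` -/

/-- `−2x/k → 0` within `{t ≠ 0}` for `x > 0`. -/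
theorem tendsto_neg_div_nhdsNE {x : ℝ} (hx : 0 < x) :
    Tendsto (fun k : ℝ => -(2 * x) / k) atTop (𝓝[≠] 0) := by
  refine tendsto_nhdsWithin_iff.mpr ⟨tendsto_id.const_div_atTop (-(2 * x)), ?_⟩
  filter_upwards [eventually_gt_atTop (0 : ℝ)] with k hk
  simp only [mem_compl_iff, mem_singleton_iff]
  exact div_ne_zero (by linarith) hk.ne'

/-- `−(k/(2x)) log(1 − 2x/k) → 1` for `x > 0` (the derivative of `log` at `1`). -/
theorem tendsto_log_ratio {x : ℝ} (hx : 0 < x) :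
    Tendsto (fun k : ℝ => (-(2 * x) / k)⁻¹ * Real.log (1 + -(2 * x) / k)) atTop (𝓝 1) := by
  have h := (Real.hasDerivAt_log one_ne_zero).tendsto_slope_zero
  simp only [Real.log_one, sub_zero, inv_one, smul_eq_mul] at h
  exact h.comp (tendsto_neg_div_nhdsNE hx)

/-- **`−½ (k − 2) log(1 − 2x/k) → x`** for `x > 0`. -/
theorem tendsto_scaled_log_threshold {x : ℝ} (hx : 0 < x) :
    Tendsto (fun k : ℝ => (k - 2) * (-(1 / 2) * Real.log (1 - 2 * x / k))) atTop (𝓝 x) := by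
  have h1 := tendsto_log_ratio hx
  have h2 : Tendsto (fun k : ℝ => x * (k - 2) / k) atTop (𝓝 x) := tendsto_mul_sub_two_div x
  have h := h1.mul h2
  rw [one_mul] at h
  refine h.congr' ?_
  filter_upwards [eventually_gt_atTop (0 : ℝ)] with k hk
  have hk0 : k ≠ 0 := hk.ne'
  rw [show (1 : ℝ) + -(2 * x) / k = 1 - 2 * x / k by ring]
  field_simp

/-! ### The tail with a general threshold -/

section measure

variable [MeasurableSpace Circle] [BorelSpace Circle]

omit [BorelSpace Circle] in
/-- The tail substitution with a general threshold: for `k > 2`,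
`∫_t^∞ e^{−(k−2)s} Φ_λ(s) ds = (k − 2)⁻¹ ∫_{(k−2)t}^∞ e^{−u} Φ_λ(u/(k − 2)) du`. -/
theorem tail_phase_eq' (lam : ℝ) {k : ℝ} (hk : 2 < k) (t : ℝ) :
    ∫ s in Ioi t, Real.exp (-((k - 2) * s)) * sphPhase lam s
      = (k - 2)⁻¹ * ∫ u in Ioi ((k - 2) * t), Real.exp (-u) * sphPhase lam (u / (k - 2)) := by
  have hc : 0 < k - 2 := by linarith
  have h := integral_comp_mul_left_Ioi (fun u : ℝ => Real.exp (-u) * sphPhase lam (u / (k - 2))) t hc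
  rw [smul_eq_mul] at h
  rw [← h]
  refine setIntegral_congr_fun measurableSet_Ioi fun s _ => ?_
  rw [mul_div_cancel_left₀ _ hc.ne']

/-- **Dominated convergence on a moving domain with any thresholds `a_k → x`**: for `x ≥ 0` and
`a_k ≥ 0` eventually, `∫_{a_k}^∞ e^{−u} Φ_λ(u/(k − 2)) du → e^{−x}`. -/
theorem tendsto_tail_integral_of_tendsto (lam : ℝ) {x : ℝ} (hx : 0 ≤ x) {a : ℝ → ℝ}
    (ha : Tendsto a atTop (𝓝 x)) (ha0 : ∀ᶠ k in atTop, 0 ≤ a k) :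
    Tendsto (fun k : ℝ => ∫ u in Ioi (a k), Real.exp (-u) * sphPhase lam (u / (k - 2)))
      atTop (𝓝 (Real.exp (-x))) := by
  set C : ℝ := Real.exp (|lam - 1| * Real.log 2) with hC
  have hlim := tendsto_integral_filter_of_dominated_convergence (μ := volume.restrict (Ioi (0 : ℝ)))
    (l := atTop)
    (F := fun k u => (Ioi (a k)).indicator (fun u => Real.exp (-u) * sphPhase lam (u / (k - 2))) u)
    (f := fun u => (Ioi x).indicator (fun u => Real.exp (-u)) u)
    (fun u => C * Real.exp (-(u / 2)))
    (Filter.Eventually.of_forall fun k => ?_) ?_ (integrableOn_exp_neg_half_Ioi.const_mul C) ?_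
  · rw [integral_indicator_exp_neg hx] at hlim
    refine hlim.congr' ?_
    filter_upwards [ha0] with k hk
    rw [integral_indicator measurableSet_Ioi, Measure.restrict_restrict measurableSet_Ioi,
      Ioi_inter_Ioi, show max (a k) 0 = a k from max_eq_left hk]
  · exact ((Real.continuous_exp.comp continuous_neg).mul
      ((continuous_sphPhase lam).comp (continuous_id.div_const _))).aestronglyMeasurable.indicator
      measurableSet_Ioi
  · filter_upwards [eventually_gt_atTop (2 + 2 * |lam - 1|)] with k hk
    filter_upwards [ae_restrict_mem measurableSet_Ioi] with u hu
    rw [mem_Ioi] at hu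
    have hk2 : 0 < k - 2 := by linarith [abs_nonneg (lam - 1)]
    have hΦ : sphPhase lam (u / (k - 2)) ≤ C * Real.exp (u / 2) := by
      refine (sphPhase_le_exp lam (div_nonneg hu.le hk2.le)).trans ?_
      refine mul_le_mul_of_nonneg_left (Real.exp_le_exp.mpr ?_) (Real.exp_pos _).le
      rw [mul_div_assoc', div_le_div_iff₀ hk2 two_pos]
      nlinarith [abs_nonneg (lam - 1)]
    have hval : Real.exp (-u) * sphPhase lam (u / (k - 2)) ≤ C * Real.exp (-(u / 2)) := by
      calc Real.exp (-u) * sphPhase lam (u / (k - 2))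
          ≤ Real.exp (-u) * (C * Real.exp (u / 2)) :=
            mul_le_mul_of_nonneg_left hΦ (Real.exp_pos _).le
        _ = C * (Real.exp (-u) * Real.exp (u / 2)) := by ring
        _ = C * Real.exp (-(u / 2)) := by
            rw [← Real.exp_add]
            congr 2
            ring
    have hnn : 0 ≤ Real.exp (-u) * sphPhase lam (u / (k - 2)) :=
      mul_nonneg (Real.exp_pos _).le (sphPhase_pos lam _).le
    by_cases hmem : u ∈ Ioi (a k)
    · rw [indicator_of_mem hmem, Real.norm_of_nonneg hnn]
      exact hval
    · rw [indicator_of_notMem hmem, norm_zero]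
      exact mul_nonneg (Real.exp_pos _).le (Real.exp_pos _).le
  · filter_upwards [Measure.ae_ne (volume.restrict (Ioi (0 : ℝ))) x] with u hu
    have hdiv : Tendsto (fun k : ℝ => u / (k - 2)) atTop (𝓝 0) :=
      tendsto_sub_two_atTop.const_div_atTop u
    have hΦ : Tendsto (fun k : ℝ => Real.exp (-u) * sphPhase lam (u / (k - 2))) atTop
        (𝓝 (Real.exp (-u) * 1)) := by
      have := ((continuous_sphPhase lam).tendsto 0).comp hdiv
      rw [sphPhase_zero] at this
      exact tendsto_const_nhds.mul this
    rw [mul_one] at hΦ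
    rcases lt_or_gt_of_ne hu with hlt | hgt
    · have hev : ∀ᶠ k : ℝ in atTop, u ∉ Ioi (a k) := by
        filter_upwards [ha.eventually (eventually_gt_nhds hlt)] with k hk
        rw [mem_Ioi, not_lt]
        exact hk.le
      have hzero : (Ioi x).indicator (fun u => Real.exp (-u)) u = 0 :=
        indicator_of_notMem (by rw [mem_Ioi, not_lt]; exact hlt.le) _
      rw [hzero]
      refine tendsto_const_nhds.congr' ?_
      filter_upwards [hev] with k hk
      rw [indicator_of_notMem hk]
    · have hev : ∀ᶠ k : ℝ in atTop, u ∈ Ioi (a k) := by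
        filter_upwards [ha.eventually (eventually_lt_nhds hgt)] with k hk
        exact hk
      have hone : (Ioi x).indicator (fun u => Real.exp (-u)) u = Real.exp (-u) :=
        indicator_of_mem hgt _
      rw [hone]
      refine hΦ.congr' ?_
      filter_upwards [hev] with k hk
      rw [indicator_of_mem hk]

/-- **The limit law with any thresholds**: if `t_k ≥ 0` eventually and `(k − 2) t_k → x ≥ 0`, then
`P_{k,λ}(log|a| > t_k) → e^{−x}`. -/
theorem tendsto_phase_tail_prob_of_tendsto (lam : ℝ) {x : ℝ} (hx : 0 ≤ x) {t : ℝ → ℝ}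
    (ht : Tendsto (fun k : ℝ => (k - 2) * t k) atTop (𝓝 x)) (ht0 : ∀ᶠ k in atTop, 0 ≤ t k) :
    Tendsto (fun k : ℝ =>
        (∫ g in {g : SU11 | t k < Real.log ‖mat g 0 0‖},
            (1 - ‖orbit g‖ ^ 2) ^ (k / 2) * sph lam g ∂(nu haarCircle))
          / ∫ g, (1 - ‖orbit g‖ ^ 2) ^ (k / 2) * sph lam g ∂(nu haarCircle))
      atTop (𝓝 (Real.exp (-x))) := by
  have hpi : (2 * π : ℝ) ≠ 0 := by positivity
  have hA : Tendsto (fun k : ℝ => 2 * π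
      / ((k - 2) * ∫ g, (1 - ‖orbit g‖ ^ 2) ^ (k / 2) * sph lam g ∂(nu haarCircle)))
      atTop (𝓝 (2 * π / (2 * π))) :=
    tendsto_const_nhds.div (tendsto_sub_two_mul_jacobi_weight lam) hpi
  rw [div_self hpi] at hA
  have ha0 : ∀ᶠ k : ℝ in atTop, 0 ≤ (k - 2) * t k := by
    filter_upwards [eventually_gt_atTop (2 : ℝ), ht0] with k hk hk0
    exact mul_nonneg (by linarith) hk0
  have h := hA.mul (tendsto_tail_integral_of_tendsto lam hx ht ha0)
  rw [one_mul] at h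
  refine h.congr' ?_
  filter_upwards [eventually_gt_atTop (max 2 (max lam (2 - lam))), ht0] with k hk hk0
  rw [max_lt_iff, max_lt_iff] at hk
  have hk2 : k - 2 ≠ 0 := by linarith
  have hm : ∫ g, (1 - ‖orbit g‖ ^ 2) ^ (k / 2) * sph lam g ∂(nu haarCircle) ≠ 0 :=
    (jacobi_pos (by linarith) (by linarith) (by linarith)).ne'
  rw [integral_phase_tail_eq (by linarith) (by linarith) (by linarith) hk0, tail_phase_eq' lam hk.1 (t k)]
  field_simp

/-! ### The orbit radius -/

/-- **THE RESCALED ORBIT RADIUS CONVERGES IN LAW TO `Exp(1)`**: for every `λ` and `x > 0`,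
`P_{k,λ}(|g·0|² > 2x/k) → e^{−x}` as `k → ∞`. -/
theorem tendsto_orbit_sq_tail_prob_atTop (lam : ℝ) {x : ℝ} (hx : 0 < x) :
    Tendsto (fun k : ℝ =>
        (∫ g in {g : SU11 | 2 * x / k < ‖orbit g‖ ^ 2},
            (1 - ‖orbit g‖ ^ 2) ^ (k / 2) * sph lam g ∂(nu haarCircle))
          / ∫ g, (1 - ‖orbit g‖ ^ 2) ^ (k / 2) * sph lam g ∂(nu haarCircle))
      atTop (𝓝 (Real.exp (-x))) := by
  have ht0 : ∀ᶠ k : ℝ in atTop, 0 ≤ -(1 / 2) * Real.log (1 - 2 * x / k) := by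
    filter_upwards [eventually_gt_atTop (2 * x)] with k hk
    have hk0 : 0 < k := by linarith
    have hy : 2 * x / k < 1 := by rw [div_lt_one hk0]; linarith
    have hy0 : 0 < 2 * x / k := by positivity
    have := Real.log_nonpos (by linarith) (by linarith : 1 - 2 * x / k ≤ 1)
    linarith
  have h := tendsto_phase_tail_prob_of_tendsto lam hx.le (tendsto_scaled_log_threshold hx) ht0
  refine h.congr' ?_
  filter_upwards [eventually_gt_atTop (2 * x)] with k hk
  have hk0 : 0 < k := by linarith
  have hy : 2 * x / k < 1 := by rw [div_lt_one hk0]; linarith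
  rw [setOf_norm_orbit_sq_gt_eq hy]

end measure

end Summit.Ventures.HodgeRepro2.T5SU11JacobiOrbitLawAsymptotic
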